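import Literature.NumberTheory.LFunctions.GaussianRayHeckeZFRInputs
import Mathlib.NumberTheory.LSeries.PrimesInAP
import Mathlib.NumberTheory.LegendreSymbol.JacobiSymbol
import HarnessLib

/-!
# The Euler product of the Hecke `L`-functions `L(s, ψ)` of `ℚ(i)` over the RATIONAL primes, and the
# norm–Jacobi characters `z ↦ (a / N z)`

Topic `Literature/NumberTheory/LFunctions`, sequel to `GaussianPrimaryHeckeLSeries` (`D_ψ = ψ(1) e^{Q_ψ}`:
the Euler product of `L(s, ψ) = ∑_{z primary} ψ(z) N(z)^{-s}` over the primary primes in logarithmic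
form) and `GaussianRayHeckeZFRInputs` (`ψ = psi M χ k = χ(z)(z/|z|)^k`, `heckeL M χ k = D_ψ`).
Everything is PROVED; the only definition is the character `normJacobiChar a` (with a body).

For the comparison of `L(s, ψ)` with Euler products over `ℚ` (the symmetric square `L`-function of a
CM newform is `L(s, χ₋₄) L(s, ψ)` up to finitely many factors) one needs `L(s, ψ) = ∏_p L_p(s, ψ)` over
the rational primes `p`, with (Ireland–Rosen, Ch. 18 §6, proof of Thm. 7; Friedlander–Iwaniec (16.17))

* `p ≡ 1 (4)`, `p = N(π₀)`, `π₀` primary: `L_p = (1 − ψ(π₀)p^{-s})⁻¹(1 − ψ(π̄₀)p^{-s})⁻¹`;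
* `p ≡ 3 (4)`: `L_p = (1 − ψ(−p) p^{-2s})⁻¹` (`−p` is the primary generator of the inert prime);
* `p = 2`, and `p ∣ M` for `ψ = psi M χ k`: `L_p = 1`.

Contents:

* norms of Gaussian primes (`exists_prime_norm_eq_or_eq_sq`: `N(π) = q` or `q²`), the prime-power
  pairs `pairsNormP (p^n)` at split / inert / even `p` (`pairsNormP_prime_pow_of_norm_eq`, `mem_pairsNormP_prime_pow_of_mod_four_eq_three`,
  `pairsNormP_two_pow`), `isPrimePow_of_mem_pairsNormP`;
* the logarithmic coefficients `q_ψ(p^n)` (`qCoeffP_prime_pow_of_mod_four_eq_one/three`, `qCoeffP_two_pow`,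
  `qCoeffP_eq_zero_of_not_isPrimePow`, and `qCoeffP_psi_prime_pow_of_dvd` for `p ∣ M`);
* **`hasSum_primes_qSeries`** (`Q_ψ(s) = ∑_p ∑_{j ≥ 1} q_ψ(p^j) p^{-js}`) and **`hasProd_primes_heckeL`**
  (`heckeL M χ k s = ∏_p exp(∑_j q_ψ(p^j)p^{-js})`, `Re s > 1`), with the local factors evaluated:
  `cexp_tsum_prime_pow_of_mod_four_eq_one/three`, `tsum_prime_pow_eq_zero_of_two/of_dvd`;
* the **norm–Jacobi character** `normJacobiChar a : MulChar (ℤ[i]/(4|a|)) ℂ`, `z ↦ (a / N(z))` (Jacobi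
  symbol; well defined by `jacobiSym.mod_right`, quadratic reciprocity), with its values
  `normJacobiChar_apply_toQuot` and the unit criterion `coprime_norm_of_isUnit_toQuot`.

## References

* K. Ireland, M. Rosen, *A Classical Introduction to Modern Number Theory*, GTM 84 (1990), Ch. 18 §6,
  proof of Theorem 7. [cite: IrelandRosen1990, Ch. 18 §6, proof of Theorem 7]
* J. Friedlander, H. Iwaniec, Ann. of Math. 148 (1998), §16, (16.16)–(16.17).
  [cite: FriedlanderIwaniecAnnals1998, §16 (16.17)]

## Mathlib / tree search

Tree: `GaussianPrimaryVM.{pairsNormP, mem_pairsNormP, mem_pairsNormP_of, mem_primesP, qCoeffP, qSeries,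
LSeriesSummable_qCoeffP, dSeries_eq_mul_exp}`, `GaussianCosetTheta.{psi, heckeL_eq_dSeries, isPrimaryMul_psi,
norm_psi_le_one, psi_one}`, `GaussianPrimary.{associated_pow_mul_pow_of_norm_eq_pow,
associated_pow_of_norm_eq_pow_of_mod_four_eq_three, prime_of_norm_eq_prime, not_dvd_star_of_norm_eq_prime,
isPrimary_neg_natCast, IsPrimary.eq_of_associated, exists_isPrimary_norm_eq, self_dvd_norm, norm_dvd_norm}`,
`GaussianHecke.{two_le_norm_of_prime, natAbs_norm_cast}`, `FriedlanderIwaniecPrimes.{GaussQuot, toQuot,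
isUnit_toQuot_of_coprime, toQuot_eq_toQuot_iff}`. Mathlib: `tsum_eq_tsum_primes_of_support_subset_prime_powers`
(pattern), `Nat.Primes.prodNatEquiv`, `HasSum.prod_fiberwise`, `HasSum.cexp`, `Complex.hasSum_taylorSeries_neg_log`,
`jacobiSym.{mod_right, mul_right, one_right, legendreSym.to_jacobiSym}`.
-/

noncomputable section

open Complex Filter Topology Finset LSeries

namespace Literature.NumberTheory.LFunctions

namespace GaussianPrimaryVM


open GaussianInt GaussianHecke
open Literature.NumberTheory.QuadraticFields.GaussianPrimary

open scoped Classical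

/-! ### Norms of Gaussian primes -/

/-- **The norm of a Gaussian prime is `q` or `q²` for a rational prime `q`** (`π ∣ N(π) = ∏ q`, so
`π ∣ q` for some rational prime `q`, and `N(π) ∣ N(q) = q²`). [folklore] -/
theorem exists_prime_norm_eq_or_eq_sq {π : GaussianInt} (hπ : Prime π) :
    ∃ q : ℕ, q.Prime ∧ (π.norm.natAbs = q ∨ π.norm.natAbs = q ^ 2) := by
  set n : ℕ := π.norm.natAbs with hn
  have hn2 : 2 ≤ n := by
    have := two_le_norm_of_prime hπ
    have := natAbs_norm_cast π
    omega
  have hn0 : n ≠ 0 := by omega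
  have hdvd : π ∣ (n : GaussianInt) := by
    have h := self_dvd_norm π
    rwa [← natAbs_norm_cast π, Int.cast_natCast] at h
  rw [← Nat.prod_primeFactorsList hn0, Nat.cast_list_prod] at hdvd
  obtain ⟨a, ha, hπa⟩ := (Prime.dvd_prod_iff hπ).mp hdvd
  obtain ⟨q, hq, rfl⟩ := List.mem_map.mp ha
  have hqp : q.Prime := Nat.prime_of_mem_primeFactorsList hq
  have hnd : π.norm ∣ (q : GaussianInt).norm := norm_dvd_norm hπa
  rw [Zsqrtd.norm_natCast] at hnd
  have hnd' : n ∣ q ^ 2 := by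
    rw [hn, sq]
    have := Int.natAbs_dvd_natAbs.mpr hnd
    rwa [Int.natAbs_mul, Int.natAbs_natCast] at this
  obtain ⟨m, hm, hnm⟩ := (Nat.dvd_prime_pow hqp).mp hnd'
  refine ⟨q, hqp, ?_⟩
  interval_cases m
  · rw [pow_zero] at hnm; omega
  · left; rw [hnm, pow_one]
  · right; exact hnm

/-- A product `x^a y^b` of non-units with `a + b ≥ 2` is not prime. [folklore] -/
theorem not_prime_pow_mul_pow {x y : GaussianInt} (hx : ¬ IsUnit x) (hy : ¬ IsUnit y) {a b : ℕ}
    (hab : 2 ≤ a + b) : ¬ Prime (x ^ a * y ^ b) := by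
  intro hp
  have hirr := hp.irreducible
  rcases Nat.eq_zero_or_pos a with rfl | ha
  · -- `y^b`, `b ≥ 2`
    rw [pow_zero, one_mul] at hirr
    have := (hirr.isUnit_or_isUnit (show y ^ b = y * y ^ (b - 1) by
      rw [← pow_succ']; congr 1; omega))
    rcases this with h | h
    · exact hy h
    · exact hy (isUnit_pow_iff (by omega) |>.mp h)
  · have hsplit : x ^ a * y ^ b = x * (x ^ (a - 1) * y ^ b) := by
      rw [← mul_assoc, ← pow_succ']; congr 2; omega
    rcases hirr.isUnit_or_isUnit hsplit with h | h
    · exact hx h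
    · rcases Nat.eq_zero_or_pos b with rfl | hb
      · rw [pow_zero, mul_one] at h
        exact hx (isUnit_pow_iff (by omega) |>.mp h)
      · exact hy (isUnit_pow_iff (by omega) |>.mp (isUnit_of_mul_isUnit_right h))

/-- An element of `ℤ[i]` of norm `> 1` (as a natural number cast) is not a unit. [folklore] -/
theorem not_isUnit_of_norm_eq {x : GaussianInt} {m : ℕ} (hx : x.norm = m) (hm : 2 ≤ m) : ¬ IsUnit x := by
  rw [isUnit_iff_norm_eq_one, hx]
  exact_mod_cast (show m ≠ 1 by omega)

/-! ### The prime-power pairs `pairsNormP (p^n)` -/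

/-- If `(π, j) ∈ pairsNormP (p^n)` for a rational prime `p`, then `N(π) = p^m` for some `1 ≤ m ≤ n`.
[folklore] -/
theorem exists_norm_eq_pow_of_mem_pairsNormP {p : ℕ} (hp : p.Prime) {n : ℕ} {q : GaussianInt × ℕ}
    (hq : q ∈ pairsNormP (p ^ n)) :
    ∃ m : ℕ, 1 ≤ m ∧ m ≤ n ∧ q.1.norm.natAbs = p ^ m ∧ q.1.norm = (p : ℤ) ^ m := by
  obtain ⟨hπ, hj, hN⟩ := mem_pairsNormP.mp hq
  have hprime : Prime q.1 := (mem_primesP.mp hπ).1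
  have hdvd : q.1.norm.natAbs ∣ p ^ n := by
    rw [← hN]; exact dvd_pow_self _ (by have := (mem_Icc.mp hj).1; omega)
  obtain ⟨m, hm, hqm⟩ := (Nat.dvd_prime_pow hp).mp hdvd
  have h2 : 2 ≤ q.1.norm.natAbs := by
    have := two_le_norm_of_prime hprime
    have := natAbs_norm_cast q.1
    omega
  have hm1 : 1 ≤ m := by
    by_contra h0
    rw [show m = 0 by omega, pow_zero] at hqm
    omega
  refine ⟨m, hm1, hm, hqm, ?_⟩
  rw [← natAbs_norm_cast q.1, hqm]; push_cast; ring

/-- **Split primes**: for `p` prime, `π₀` primary of norm `p` (so `p ≡ 1 (4)`) and `n ≥ 1`,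
`pairsNormP (p^n) = {(π₀, n), (π̄₀, n)}`. [cite: IrelandRosen1990, Ch. 18 §6, proof of Theorem 7] -/
theorem pairsNormP_prime_pow_of_norm_eq {p : ℕ} (hp : p.Prime) {π₀ : GaussianInt}
    (hπ₀ : IsPrimary π₀) (h0 : π₀.norm = p) {n : ℕ} (hn : 1 ≤ n) :
    pairsNormP (p ^ n) = {(π₀, n), (star π₀, n)} := by
  have hprime₀ : Prime π₀ := prime_of_norm_eq_prime hp h0
  have hstar0 : (star π₀).norm = p := by rw [Zsqrtd.norm_conj, h0]
  have hprime₀' : Prime (star π₀) := prime_of_norm_eq_prime hp hstar0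
  have hp2 : 2 ≤ p := hp.two_le
  have hnu₀ : ¬ IsUnit π₀ := not_isUnit_of_norm_eq h0 hp2
  have hnu₀' : ¬ IsUnit (star π₀) := not_isUnit_of_norm_eq hstar0 hp2
  ext ⟨π, j⟩
  simp only [mem_insert, mem_singleton, Prod.mk.injEq]
  constructor
  · intro hq
    obtain ⟨m, hm1, -, hNat, hInt⟩ := exists_norm_eq_pow_of_mem_pairsNormP hp hq
    obtain ⟨hπ, hj, hN⟩ := mem_pairsNormP.mp hq
    obtain ⟨hprime, hprim, -⟩ := mem_primesP.mp hπ
    obtain ⟨a, ha, hassoc⟩ := associated_pow_mul_pow_of_norm_eq_pow hp h0 m π hInt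
    -- `m = 1`
    have hm : m = 1 := by
      by_contra hm
      have h2m : 2 ≤ a + (m - a) := by omega
      exact not_prime_pow_mul_pow hnu₀ hnu₀' h2m (hassoc.prime hprime)
    subst hm
    have hjn : j = n := by
      rw [hNat, pow_one] at hN
      exact Nat.pow_right_injective hp2 hN
    subst hjn
    interval_cases a
    · right
      refine ⟨hprim.eq_of_associated hπ₀.star ?_, rfl⟩
      simpa using hassoc
    · left
      refine ⟨hprim.eq_of_associated hπ₀ ?_, rfl⟩
      simpa using hassoc
  · rintro (⟨hπ, hj⟩ | ⟨hπ, hj⟩) <;> rw [hπ, hj]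
    · have := mem_pairsNormP_of hprime₀ hπ₀ hn
      rwa [show (Zsqrtd.norm π₀).natAbs = p by rw [h0]; rfl] at this
    · have := mem_pairsNormP_of hprime₀' hπ₀.star hn
      rwa [show (Zsqrtd.norm (star π₀)).natAbs = p by rw [hstar0]; rfl] at this

/-- `π₀ ≠ π̄₀` for a split prime `p = N(π₀) ≡ 1 (4)`. [folklore] -/
theorem ne_star_of_norm_eq_prime {p : ℕ} (hp : p.Prime) (hp1 : p % 4 = 1) {π₀ : GaussianInt} (h0 : π₀.norm = p) :
    π₀ ≠ star π₀ := fun h ↦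
  not_dvd_star_of_norm_eq_prime hp hp1 h0 (h ▸ dvd_rfl)

/-- **Inert primes**: for `p ≡ 3 (4)` prime and `n ≥ 1`, `(π, j) ∈ pairsNormP (p^n)` iff `n` is even and
`(π, j) = (−p, n/2)`. [cite: IrelandRosen1990, Ch. 18 §6, proof of Theorem 7] -/
theorem mem_pairsNormP_prime_pow_of_mod_four_eq_three {p : ℕ} (hp : p.Prime) (hp3 : p % 4 = 3) {n : ℕ}
    (hn : 1 ≤ n) {q : GaussianInt × ℕ} :
    q ∈ pairsNormP (p ^ n) ↔ Even n ∧ q = (-(p : GaussianInt), n / 2) := by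
  haveI : Fact p.Prime := ⟨hp⟩
  have hp2 : 2 ≤ p := hp.two_le
  have hpprime : Prime (p : GaussianInt) := (GaussianInt.prime_iff_mod_four_eq_three_of_nat_prime p).mpr hp3
  have hnegprime : Prime (-(p : GaussianInt)) := hpprime.neg
  have hnegprim : IsPrimary (-(p : GaussianInt)) := isPrimary_neg_natCast hp3
  have hnormneg : (-(p : GaussianInt)).norm = (p : ℤ) ^ 2 := by
    rw [Zsqrtd.norm_neg, Zsqrtd.norm_natCast]; ring
  have hnormnegNat : (-(p : GaussianInt)).norm.natAbs = p ^ 2 := by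
    rw [hnormneg]; simp [Int.natAbs_pow]
  have hpu : ¬ IsUnit (p : GaussianInt) := hpprime.not_unit
  constructor
  · intro hq
    obtain ⟨m, hm1, -, hNat, hInt⟩ := exists_norm_eq_pow_of_mem_pairsNormP hp hq
    obtain ⟨hπ, hj, hN⟩ := mem_pairsNormP.mp hq
    obtain ⟨hprime, hprim, -⟩ := mem_primesP.mp hπ
    obtain ⟨j', hm, hassoc⟩ := associated_pow_of_norm_eq_pow_of_mod_four_eq_three hp3 m q.1 hInt
    -- `j' = 1`
    have hj'1 : j' = 1 := by
      rcases Nat.lt_trichotomy j' 1 with h | h | h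
      · have : j' = 0 := by omega
        subst this
        rw [pow_zero] at hassoc
        exact absurd (associated_one_iff_isUnit.mp hassoc) hprime.not_unit
      · exact h
      · exfalso
        have h2 : 2 ≤ j' + 0 := by omega
        have := not_prime_pow_mul_pow (x := (p : GaussianInt)) (y := (p : GaussianInt)) hpu hpu h2
        rw [pow_zero, mul_one] at this
        exact this (hassoc.prime hprime)
    subst hj'1
    rw [pow_one] at hassoc
    have hπeq : q.1 = -(p : GaussianInt) := by
      rw [← primary_eq_of_associated hassoc.symm hprim, primary_natCast_of_mod_four_eq_three hp3]
    have hm2 : m = 2 := by omega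
    subst hm2
    -- `2 j = n`
    have h2j : p ^ (2 * q.2) = p ^ n := by rw [← hN, hNat, ← pow_mul]
    have h2j' : 2 * q.2 = n := Nat.pow_right_injective hp2 h2j
    refine ⟨⟨q.2, by omega⟩, Prod.ext hπeq ?_⟩
    simp only
    omega
  · rintro ⟨⟨r, hr⟩, rfl⟩
    have hr' : n / 2 = r := by omega
    have hr1 : 1 ≤ r := by omega
    have := mem_pairsNormP_of hnegprime hnegprim hr1
    rw [hnormnegNat, ← pow_mul, show 2 * r = n by omega] at this
    rwa [hr']

/-- **`p = 2`**: no primary prime has even norm, so `pairsNormP (2^n) = ∅`. [folklore] -/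
theorem pairsNormP_two_pow (n : ℕ) : pairsNormP (2 ^ n) = ∅ := by
  refine Finset.eq_empty_of_forall_notMem fun q hq ↦ ?_
  obtain ⟨m, hm1, -, hNat, -⟩ := exists_norm_eq_pow_of_mem_pairsNormP Nat.prime_two hq
  obtain ⟨hπ, -, -⟩ := mem_pairsNormP.mp hq
  obtain ⟨-, hprim, -⟩ := mem_primesP.mp hπ
  have hodd := hprim.norm_odd
  have : (q.1.norm.natAbs : ℤ) % 2 = 1 := by rw [natAbs_norm_cast]; exact hodd
  rw [hNat] at this
  push_cast at this
  rw [show m = (m - 1) + 1 by omega, pow_succ, Int.mul_emod_left] at this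
  exact zero_ne_one this

/-- Every `n` with a non-empty `pairsNormP n` is a prime power. [folklore] -/
theorem isPrimePow_of_mem_pairsNormP {n : ℕ} {q : GaussianInt × ℕ} (hq : q ∈ pairsNormP n) : IsPrimePow n := by
  obtain ⟨hπ, hj, hN⟩ := mem_pairsNormP.mp hq
  obtain ⟨hprime, -, -⟩ := mem_primesP.mp hπ
  have hj1 : 1 ≤ q.2 := (mem_Icc.mp hj).1
  obtain ⟨r, hr, h⟩ := exists_prime_norm_eq_or_eq_sq hprime
  rw [← hN]
  rcases h with h | h
  · rw [h]; exact ⟨r, q.2, hr.prime, hj1, rfl⟩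
  · rw [h, ← pow_mul]; exact ⟨r, 2 * q.2, hr.prime, by omega, rfl⟩

/-! ### The logarithmic coefficients `q_ψ` at prime powers -/

variable {ψ : GaussianInt → ℂ}

/-- `q_ψ(n) = 0` unless `n` is a prime power. [folklore] -/
theorem qCoeffP_eq_zero_of_not_isPrimePow {n : ℕ} (hn : ¬ IsPrimePow n) : qCoeffP ψ n = 0 := by
  rw [qCoeffP]
  refine Finset.sum_eq_zero fun q hq ↦ ?_
  exact absurd (isPrimePow_of_mem_pairsNormP hq) hn

/-- **Split**: `q_ψ(p^n) = (ψ(π₀)^n + ψ(π̄₀)^n)/n` for `p ≡ 1 (4)`, `N(π₀) = p`, `π₀` primary, `n ≥ 1`.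
[cite: IrelandRosen1990, Ch. 18 §6, proof of Theorem 7] -/
theorem qCoeffP_prime_pow_of_mod_four_eq_one {p : ℕ} (hp : p.Prime) (hp1 : p % 4 = 1) {π₀ : GaussianInt}
    (hπ₀ : IsPrimary π₀) (h0 : π₀.norm = p) {n : ℕ} (hn : 1 ≤ n) :
    qCoeffP ψ (p ^ n) = (ψ π₀ ^ n + ψ (star π₀) ^ n) / n := by
  rw [qCoeffP, pairsNormP_prime_pow_of_norm_eq hp hπ₀ h0 hn, Finset.sum_pair]
  · simp only; ring
  · intro h
    exact ne_star_of_norm_eq_prime hp hp1 h0 (Prod.mk.inj h).1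

/-- **Inert**: `q_ψ(p^n) = ψ(−p)^{n/2}/(n/2)` for `p ≡ 3 (4)` and even `n ≥ 1`, and `0` for odd `n`.
[cite: IrelandRosen1990, Ch. 18 §6, proof of Theorem 7] -/
theorem qCoeffP_prime_pow_of_mod_four_eq_three {p : ℕ} (hp : p.Prime) (hp3 : p % 4 = 3) {n : ℕ}
    (hn : 1 ≤ n) :
    qCoeffP ψ (p ^ n) = if Even n then ψ (-(p : GaussianInt)) ^ (n / 2) / (n / 2 : ℕ) else 0 := by
  rw [qCoeffP]
  split_ifs with he
  · have hset : pairsNormP (p ^ n) = {(-(p : GaussianInt), n / 2)} := by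
      ext q
      rw [mem_pairsNormP_prime_pow_of_mod_four_eq_three hp hp3 hn, mem_singleton]
      exact ⟨fun h ↦ h.2, fun h ↦ ⟨he, h⟩⟩
    rw [hset, sum_singleton]
  · refine Finset.sum_eq_zero fun q hq ↦ ?_
    exact absurd ((mem_pairsNormP_prime_pow_of_mod_four_eq_three hp hp3 hn).mp hq).1 he

/-- **Even**: `q_ψ(2^n) = 0`. [folklore] -/
theorem qCoeffP_two_pow (n : ℕ) : qCoeffP ψ (2 ^ n) = 0 := by
  rw [qCoeffP, pairsNormP_two_pow n, sum_empty]

/-! ### The Euler product over the rational primes: `Q_ψ(s) = ∑_p ∑_{j ≥ 1} q_ψ(p^j) p^{-js}` -/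

/-- `(p^m)^{-s} = (p^{-s})^m` for natural `p`, `m`. [folklore] -/
theorem natCast_pow_cpow_neg (p m : ℕ) (s : ℂ) :
    (((p ^ m : ℕ) : ℂ)) ^ (-s) = ((p : ℂ) ^ (-s)) ^ m := by
  induction m with
  | zero => simp
  | succ m ih => rw [pow_succ, Nat.cast_mul, Complex.natCast_mul_natCast_cpow, ih, pow_succ]

/-- The `L`-series term of `q_ψ` at a prime power: `q_ψ(p^m) (p^{-s})^m` (`p` prime). [folklore] -/
theorem term_qCoeffP_prime_pow {p : ℕ} (hp : p.Prime) (s : ℂ) (m : ℕ) :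
    term (qCoeffP ψ) s (p ^ m) = qCoeffP ψ (p ^ m) * ((p : ℂ) ^ (-s)) ^ m := by
  rw [term_of_ne_zero (pow_ne_zero _ hp.ne_zero), ← natCast_pow_cpow_neg, div_eq_mul_inv,
    ← cpow_neg]

/-- **`Q_ψ(s) = ∑_p ∑_{j ≥ 0} q_ψ(p^{j+1}) p^{-(j+1)s}`** (as a `HasSum` over `Nat.Primes`), for
`Re s > 1` and `|ψ| ≤ 1` on primary elements: the terms of `L(q_ψ, s)` vanish off the prime powers.
[cite: FriedlanderIwaniecAnnals1998, §16 (16.17)] -/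
theorem hasSum_primes_qSeries (hbd : ∀ z, IsPrimary z → ‖ψ z‖ ≤ 1) {s : ℂ} (hs : 1 < s.re) :
    HasSum (fun p : Nat.Primes ↦ ∑' j : ℕ, term (qCoeffP ψ) s ((p : ℕ) ^ (j + 1))) (qSeries ψ s) := by
  set f : ℕ → ℂ := term (qCoeffP ψ) s with hf
  have hsum : Summable f := LSeriesSummable_qCoeffP hbd hs
  have hsupp : Function.support f ⊆ {n | IsPrimePow n} := by
    intro n hn
    by_contra hnp
    refine hn ?_
    rcases eq_or_ne n 0 with rfl | hn0
    · exact term_zero _ _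
    · rw [hf, term_of_ne_zero hn0, qCoeffP_eq_zero_of_not_isPrimePow hnp, zero_div]
  -- summability on `Nat.Primes × ℕ` through `prodNatEquiv`
  have hsum' : Summable fun pk : Nat.Primes × ℕ ↦ f (pk.1 ^ (pk.2 + 1)) :=
    Nat.Primes.prodNatEquiv.symm.summable_iff.mp <| by
      simpa only [← Nat.Primes.coe_prodNatEquiv_apply, Prod.eta, Function.comp_def,
        Equiv.apply_symm_apply] using hsum.subtype _
  have htot : ∑' pk : Nat.Primes × ℕ, f (pk.1 ^ (pk.2 + 1)) = qSeries ψ s := by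
    rw [qSeries, LSeries, show (∑' n, term (qCoeffP ψ) s n) = ∑' n, f n from rfl,
      tsum_eq_tsum_primes_of_support_subset_prime_powers hsum hsupp, hsum'.tsum_prod]
  rw [← htot]
  exact hsum'.hasSum.prod_fiberwise fun p ↦ (hsum'.prod_factor p).hasSum

/-! ### The local factors `exp(∑_{j ≥ 1} q_ψ(p^j) p^{-js})` -/

/-- `∑_{j ≥ 0} z^{j+1}/(j+1) = −log(1 − z)` for `|z| < 1`. [folklore] -/
theorem hasSum_pow_succ_div_neg_log {z : ℂ} (hz : ‖z‖ < 1) :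
    HasSum (fun j : ℕ ↦ z ^ (j + 1) / ((j + 1 : ℕ) : ℂ)) (-Complex.log (1 - z)) := by
  have h := (hasSum_nat_add_iff' (f := fun n : ℕ ↦ z ^ n / (n : ℂ)) 1).mpr
    (Complex.hasSum_taylorSeries_neg_log hz)
  simpa using h

/-- `exp(−log(1 − z)) = (1 − z)⁻¹` for `|z| < 1`. [folklore] -/
theorem cexp_neg_log_one_sub {z : ℂ} (hz : ‖z‖ < 1) : cexp (-Complex.log (1 - z)) = (1 - z)⁻¹ := by
  have h1 : 1 - z ≠ 0 := by
    intro h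
    have : z = 1 := by linear_combination -h
    rw [this, norm_one] at hz
    exact lt_irrefl _ hz
  rw [Complex.exp_neg, Complex.exp_log h1]

/-- `|p^{-s}| < 1` for a prime `p` and `Re s > 0`. [folklore] -/
theorem norm_prime_cpow_neg_lt_one {p : ℕ} (hp : p.Prime) {s : ℂ} (hs : 0 < s.re) :
    ‖(p : ℂ) ^ (-s)‖ < 1 := by
  rw [Complex.norm_natCast_cpow_of_pos hp.pos, neg_re]
  exact Real.rpow_lt_one_of_one_lt_of_neg (by exact_mod_cast hp.one_lt) (by linarith)

/-- **The split local factor**: for `p = N(π₀)` prime, `π₀` primary, `p ≡ 1 (4)`, `|ψ| ≤ 1` on primary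
elements and `Re s > 0`:
`exp(∑_{j ≥ 1} q_ψ(p^j) p^{-js}) = (1 − ψ(π₀) p^{-s})⁻¹ (1 − ψ(π̄₀) p^{-s})⁻¹`.
[cite: IrelandRosen1990, Ch. 18 §6, proof of Theorem 7] -/
theorem cexp_tsum_prime_pow_of_norm_eq {p : ℕ} (hp : p.Prime) (hp1 : p % 4 = 1) {π₀ : GaussianInt}
    (hπ₀ : IsPrimary π₀) (h0 : π₀.norm = p) (hbd : ∀ z, IsPrimary z → ‖ψ z‖ ≤ 1) {s : ℂ} (hs : 0 < s.re) :
    cexp (∑' j : ℕ, term (qCoeffP ψ) s (p ^ (j + 1))) =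
      (1 - ψ π₀ * (p : ℂ) ^ (-s))⁻¹ * (1 - ψ (star π₀) * (p : ℂ) ^ (-s))⁻¹ := by
  set y : ℂ := (p : ℂ) ^ (-s) with hy
  have hy1 : ‖y‖ < 1 := norm_prime_cpow_neg_lt_one hp hs
  have hu : ‖ψ π₀ * y‖ < 1 := by
    rw [norm_mul]
    calc ‖ψ π₀‖ * ‖y‖ ≤ 1 * ‖y‖ := by gcongr; exact hbd _ hπ₀
      _ < 1 := by rw [one_mul]; exact hy1
  have hv : ‖ψ (star π₀) * y‖ < 1 := by
    rw [norm_mul]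
    calc ‖ψ (star π₀)‖ * ‖y‖ ≤ 1 * ‖y‖ := by gcongr; exact hbd _ hπ₀.star
      _ < 1 := by rw [one_mul]; exact hy1
  have hsum : HasSum (fun j : ℕ ↦ term (qCoeffP ψ) s (p ^ (j + 1)))
      (-Complex.log (1 - ψ π₀ * y) + -Complex.log (1 - ψ (star π₀) * y)) := by
    refine ((hasSum_pow_succ_div_neg_log hu).add (hasSum_pow_succ_div_neg_log hv)).congr_fun ?_
    intro j
    rw [term_qCoeffP_prime_pow hp, qCoeffP_prime_pow_of_mod_four_eq_one hp hp1 hπ₀ h0 (by omega),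
      ← hy, mul_pow, mul_pow]
    push_cast
    ring
  rw [hsum.tsum_eq, Complex.exp_add, cexp_neg_log_one_sub hu, cexp_neg_log_one_sub hv]

/-- **The inert local factor**: for `p ≡ 3 (4)` prime, `|ψ| ≤ 1` on primary elements and `Re s > 0`:
`exp(∑_{j ≥ 1} q_ψ(p^j) p^{-js}) = (1 − ψ(−p) p^{-2s})⁻¹`. [cite: IrelandRosen1990, Ch. 18 §6, proof of Theorem 7] -/
theorem cexp_tsum_prime_pow_of_mod_four_eq_three {p : ℕ} (hp : p.Prime) (hp3 : p % 4 = 3)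
    (hbd : ∀ z, IsPrimary z → ‖ψ z‖ ≤ 1) {s : ℂ} (hs : 0 < s.re) :
    cexp (∑' j : ℕ, term (qCoeffP ψ) s (p ^ (j + 1))) =
      (1 - ψ (-(p : GaussianInt)) * ((p : ℂ) ^ (-s)) ^ 2)⁻¹ := by
  set y : ℂ := (p : ℂ) ^ (-s) with hy
  set w : ℂ := ψ (-(p : GaussianInt)) with hw
  have hy1 : ‖y‖ < 1 := norm_prime_cpow_neg_lt_one hp hs
  have hwy : ‖w * y ^ 2‖ < 1 := by
    rw [norm_mul, norm_pow]
    have h1 : ‖w‖ ≤ 1 := hbd _ (isPrimary_neg_natCast hp3)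
    have h2 : ‖y‖ ^ 2 < 1 := pow_lt_one₀ (norm_nonneg _) hy1 two_ne_zero
    calc ‖w‖ * ‖y‖ ^ 2 ≤ 1 * ‖y‖ ^ 2 := by gcongr
      _ < 1 := by rw [one_mul]; exact h2
  -- the terms vanish at odd exponents and give the `log`-series at even ones
  set f : ℕ → ℂ := fun j ↦ term (qCoeffP ψ) s (p ^ (j + 1)) with hf
  have hf_eval : ∀ j, f j = if Even (j + 1) then w ^ ((j + 1) / 2) / (((j + 1) / 2 : ℕ) : ℂ) * y ^ (j + 1)
      else 0 := by
    intro j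
    rw [hf]
    simp only
    rw [term_qCoeffP_prime_pow hp, qCoeffP_prime_pow_of_mod_four_eq_three hp hp3 (by omega), ← hy, ← hw]
    split_ifs <;> simp
  set ι : ℕ → ℕ := fun m ↦ 2 * m + 1 with hι
  have hinj : Function.Injective ι := fun a b h ↦ by simp only [hι] at h; omega
  have hvanish : ∀ x ∉ Set.range ι, f x = 0 := by
    intro x hx
    rw [hf_eval, if_neg]
    rintro ⟨r, hr⟩
    exact hx ⟨r - 1, by show 2 * (r - 1) + 1 = x; omega⟩
  have hcomp : f ∘ ι = fun m : ℕ ↦ (w * y ^ 2) ^ (m + 1) / ((m + 1 : ℕ) : ℂ) := by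
    funext m
    simp only [Function.comp, hι]
    rw [hf_eval, if_pos ⟨m + 1, by omega⟩, show (2 * m + 1 + 1) / 2 = m + 1 by omega,
      show 2 * m + 1 + 1 = 2 * (m + 1) by omega, pow_mul, mul_pow]
    ring
  have hsum : HasSum f (-Complex.log (1 - w * y ^ 2)) := by
    rw [← hinj.hasSum_iff hvanish, hcomp]
    exact hasSum_pow_succ_div_neg_log hwy
  rw [hsum.tsum_eq, cexp_neg_log_one_sub hwy]

/-- **The local factor at `2` is `1`**: `∑_{j ≥ 1} q_ψ(2^j) 2^{-js} = 0`. [folklore] -/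
theorem tsum_term_two_pow (s : ℂ) : ∑' j : ℕ, term (qCoeffP ψ) s (2 ^ (j + 1)) = 0 := by
  rw [tsum_congr fun j ↦ by rw [term_qCoeffP_prime_pow Nat.prime_two, qCoeffP_two_pow, zero_mul],
    tsum_zero]

end GaussianPrimaryVM

namespace GaussianCosetTheta


open GaussianInt GaussianHecke GaussianPrimaryVM
open Literature.NumberTheory.QuadraticFields.GaussianPrimary
open Literature.NumberTheory.Sieve.FriedlanderIwaniecPrimes (GaussQuot toQuot toQuot_eq_toQuot_iff isUnit_toQuot_of_coprime)

open scoped Classical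

variable {M : ℕ} [NeZero M]

/-- **`L(s, ψ) = ∏_p exp(∑_{j ≥ 1} q_ψ(p^j) p^{-js})` over the rational primes** for `ψ = psi M χ k`,
`4 ∣ M`, `Re s > 1` (`heckeL = D_ψ = e^{Q_ψ}` and `hasSum_primes_qSeries`).
[cite: FriedlanderIwaniecAnnals1998, §16 (16.17)] -/
theorem hasProd_primes_heckeL (h4 : 4 ∣ M) (χ : MulChar (GaussQuot M) ℂ) (k : ℕ) {s : ℂ} (hs : 1 < s.re) :
    HasProd (fun p : Nat.Primes ↦ cexp (∑' j : ℕ, term (qCoeffP (psi M χ k)) s ((p : ℕ) ^ (j + 1))))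
      (heckeL M χ k s) := by
  have hbd : ∀ z, IsPrimary z → ‖psi M χ k z‖ ≤ 1 := fun z _ ↦ norm_psi_le_one χ k z
  have h := (hasSum_primes_qSeries hbd hs).cexp
  rw [heckeL_eq_dSeries h4 χ k hs, dSeries_eq_mul_exp (isPrimaryMul_psi χ k) hbd hs, psi_one, one_mul]
  exact h

/-! ### Units modulo `M` and the vanishing of `ψ` at the primes over `p ∣ M` -/

omit [NeZero M] in
/-- `N(x + M y) ≡ N(x) (mod M)`. [folklore] -/
theorem norm_add_natCast_mul_emod (x y : GaussianInt) : (x + M * y).norm % M = x.norm % M := by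
  have : (x + M * y).norm = x.norm +
      M * (2 * x.re * y.re + M * y.re * y.re + 2 * x.im * y.im + M * y.im * y.im) := by
    simp only [Zsqrtd.norm_def, Zsqrtd.re_add, Zsqrtd.im_add, Zsqrtd.re_mul, Zsqrtd.im_mul,
      Zsqrtd.re_natCast, Zsqrtd.im_natCast]
    ring
  rw [this, Int.add_mul_emod_self_left]

omit [NeZero M] in
/-- Congruent elements have congruent norms. [folklore] -/
theorem norm_emod_eq_of_toQuot_eq {z w : GaussianInt} (h : toQuot M z = toQuot M w) : z.norm % M = w.norm % M := by
  obtain ⟨y, hy⟩ := (toQuot_eq_toQuot_iff z w).mp h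
  have hz : z = w + M * y := by rw [← hy]; ring
  rw [hz, norm_add_natCast_mul_emod]

omit [NeZero M] in
/-- **A unit class modulo `M` has norm prime to `M`**: if `z` is invertible mod `M` then
`(N z, M) = 1` (`z w ≡ 1 ⇒ N(z)N(w) ≡ 1 (mod M)`). [folklore] -/
theorem coprime_norm_of_isUnit_toQuot {z : GaussianInt} (hz : IsUnit (toQuot M z)) : Nat.Coprime z.norm.natAbs M := by
  obtain ⟨u, hu⟩ := hz
  obtain ⟨w, hw⟩ := Ideal.Quotient.mk_surjective (↑u⁻¹ : GaussQuot M)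
  have h1 : toQuot M (z * w) = toQuot M 1 := by
    rw [map_mul, map_one, show toQuot M w = ↑u⁻¹ from hw, ← hu, Units.mul_inv]
  have h2 : z.norm * w.norm ≡ 1 [ZMOD M] := by
    have := norm_emod_eq_of_toQuot_eq h1
    rwa [Zsqrtd.norm_mul, Zsqrtd.norm_one] at this
  have hM : (M : ℤ) ∣ 1 - z.norm * w.norm := h2.dvd
  set g : ℕ := z.norm.natAbs.gcd M with hg
  have hg1 : (g : ℤ) ∣ z.norm := by
    rw [← natAbs_norm_cast z]; exact_mod_cast Nat.gcd_dvd_left _ _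
  have hg2 : (g : ℤ) ∣ (M : ℤ) := by exact_mod_cast Nat.gcd_dvd_right _ _
  have hg3 : (g : ℤ) ∣ 1 := by
    have := (hg2.trans hM).add (hg1.mul_right w.norm)
    rwa [sub_add_cancel] at this
  exact Nat.dvd_one.mp (Int.natCast_dvd_natCast.mp hg3)

omit [NeZero M] in
/-- **`ψ = psi M χ k` vanishes at `z` when `N z` is not prime to `M`** (the class of `z` is not a unit).
[cite: FriedlanderIwaniecAnnals1998, (16.16)] -/
theorem psi_eq_zero_of_not_coprime (χ : MulChar (GaussQuot M) ℂ) (k : ℕ) {z : GaussianInt}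
    (hz : ¬ Nat.Coprime z.norm.natAbs M) : psi M χ k z = 0 := by
  rw [psi, χ.map_nonunit (fun hu ↦ hz (coprime_norm_of_isUnit_toQuot hu)), zero_mul]

omit [NeZero M] in
/-- For a prime `p ∣ M`: `q_ψ(p^n) = 0` for `ψ = psi M χ k` (every primary prime of norm a power
of `p` has a non-unit class mod `M`). [cite: FriedlanderIwaniecAnnals1998, (16.16)–(16.17)] -/
theorem qCoeffP_psi_prime_pow_of_dvd (χ : MulChar (GaussQuot M) ℂ) (k : ℕ) {p : ℕ} (hp : p.Prime)
    (hpM : p ∣ M) (n : ℕ) : qCoeffP (psi M χ k) (p ^ n) = 0 := by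
  rw [qCoeffP]
  refine Finset.sum_eq_zero fun q hq ↦ ?_
  obtain ⟨m, hm1, -, hNat, -⟩ := exists_norm_eq_pow_of_mem_pairsNormP hp hq
  have hj : 1 ≤ q.2 := (mem_Icc.mp (mem_pairsNormP.mp hq).2.1).1
  have hnc : ¬ Nat.Coprime q.1.norm.natAbs M := by
    rw [hNat]
    intro hc
    have := Nat.Coprime.coprime_dvd_left (dvd_pow_self p (by omega)) hc
    exact (Nat.Prime.coprime_iff_not_dvd hp).mp this hpM
  rw [psi_eq_zero_of_not_coprime χ k hnc, zero_pow (by omega), zero_div]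

omit [NeZero M] in
/-- **The local factor at a prime `p ∣ M` is `1`** for `ψ = psi M χ k`. [cite: FriedlanderIwaniecAnnals1998, (16.17)] -/
theorem tsum_term_prime_pow_of_dvd (χ : MulChar (GaussQuot M) ℂ) (k : ℕ) {p : ℕ} (hp : p.Prime) (hpM : p ∣ M)
    (s : ℂ) : ∑' j : ℕ, term (qCoeffP (psi M χ k)) s (p ^ (j + 1)) = 0 := by
  rw [tsum_congr fun j ↦ by rw [term_qCoeffP_prime_pow hp, qCoeffP_psi_prime_pow_of_dvd χ k hp hpM, zero_mul],
    tsum_zero]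

/-! ### The norm–Jacobi characters `z ↦ (a / N(z))` modulo `4|a|` -/

section NormJacobi

/-- A representative of a class modulo `M`. [folklore] -/
def classRep' (q : GaussQuot M) : GaussianInt := (Ideal.Quotient.mk_surjective q).choose

omit [NeZero M] in
/-- `classRep'` is a representative. [folklore] -/
theorem toQuot_classRep' (q : GaussQuot M) : toQuot M (classRep' q) = q :=
  (Ideal.Quotient.mk_surjective q).choose_spec

omit [NeZero M] in
/-- A number prime to an even modulus is odd. [folklore] -/
theorem odd_of_coprime_of_two_dvd {n : ℕ} (h2 : 2 ∣ M) (h : Nat.Coprime n M) : Odd n := by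
  rw [Nat.odd_iff]
  by_contra hne
  have h2n : 2 ∣ n := Nat.dvd_of_mod_eq_zero (by omega)
  have := Nat.dvd_gcd h2n h2
  rw [h] at this
  omega

/-- **Periodicity**: for `z ≡ w (mod 4|a|)` with odd norms, `(a / N z) = (a / N w)` (Jacobi symbols;
`jacobiSym.mod_right`, i.e. quadratic reciprocity). [folklore] -/
theorem jacobiSym_norm_eq_of_toQuot_eq {a : ℤ} {z w : GaussianInt}
    (h : toQuot (4 * a.natAbs) z = toQuot (4 * a.natAbs) w) (hz : Odd z.norm.natAbs) (hw : Odd w.norm.natAbs) :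
    jacobiSym a z.norm.natAbs = jacobiSym a w.norm.natAbs := by
  have hmod := norm_emod_eq_of_toQuot_eq h
  have hmodN : z.norm.natAbs % (4 * a.natAbs) = w.norm.natAbs % (4 * a.natAbs) := by
    have h1 : ((z.norm.natAbs : ℕ) : ℤ) % ((4 * a.natAbs : ℕ) : ℤ) =
        ((w.norm.natAbs : ℕ) : ℤ) % ((4 * a.natAbs : ℕ) : ℤ) := by
      rw [natAbs_norm_cast, natAbs_norm_cast]; exact hmod
    have h2 : ((z.norm.natAbs % (4 * a.natAbs) : ℕ) : ℤ) = ((w.norm.natAbs % (4 * a.natAbs) : ℕ) : ℤ) := by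
      rw [Int.natCast_mod, Int.natCast_mod]; exact h1
    exact_mod_cast h2
  rw [jacobiSym.mod_right a hz, jacobiSym.mod_right a hw, hmodN]

/-- **The norm–Jacobi character** `(a / N(·))` on `(ℤ[i]/(4|a|))ˣ`, extended by `0`: the value at a unit
class `q` is the Jacobi symbol `(a / N z)` of any representative `z` (well defined by
`jacobiSym_norm_eq_of_toQuot_eq`), and `0` at non-units. For `a = (−1)^{·}·squarefree` this is the
Dirichlet-type part of the Grössencharakter `λ(𝔞) = (a / N𝔞)(α/|α|)²` of the CM newforms with
`j = 1728`. [folklore] -/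
def normJacobiChar (a : ℤ) : MulChar (GaussQuot (4 * a.natAbs)) ℂ where
  toFun q := if IsUnit q then ((jacobiSym a (classRep' q).norm.natAbs : ℤ) : ℂ) else 0
  map_one' := by
    rw [if_pos isUnit_one]
    have h4 : 2 ∣ 4 * a.natAbs := Dvd.dvd.mul_right (by norm_num) _
    have hrep : toQuot (4 * a.natAbs) (classRep' (1 : GaussQuot (4 * a.natAbs))) =
        toQuot (4 * a.natAbs) 1 := by rw [toQuot_classRep', map_one]
    have hodd : Odd (classRep' (1 : GaussQuot (4 * a.natAbs))).norm.natAbs := by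
      refine odd_of_coprime_of_two_dvd h4 (coprime_norm_of_isUnit_toQuot ?_)
      rw [toQuot_classRep']; exact isUnit_one
    rw [jacobiSym_norm_eq_of_toQuot_eq hrep hodd (by simp [Zsqrtd.norm_one]), Zsqrtd.norm_one]
    simp [jacobiSym.one_right]
  map_mul' q₁ q₂ := by
    by_cases h₁ : IsUnit q₁
    · by_cases h₂ : IsUnit q₂
      · have h12 : IsUnit (q₁ * q₂) := h₁.mul h₂
        rw [if_pos h12, if_pos h₁, if_pos h₂]
        have h4 : 2 ∣ 4 * a.natAbs := Dvd.dvd.mul_right (by norm_num) _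
        have hu1 : IsUnit (toQuot (4 * a.natAbs) (classRep' q₁)) := by rwa [toQuot_classRep']
        have hu2 : IsUnit (toQuot (4 * a.natAbs) (classRep' q₂)) := by rwa [toQuot_classRep']
        have hu12 : IsUnit (toQuot (4 * a.natAbs) (classRep' (q₁ * q₂))) := by rwa [toQuot_classRep']
        have ho1 := odd_of_coprime_of_two_dvd h4 (coprime_norm_of_isUnit_toQuot hu1)
        have ho2 := odd_of_coprime_of_two_dvd h4 (coprime_norm_of_isUnit_toQuot hu2)
        have ho12 := odd_of_coprime_of_two_dvd h4 (coprime_norm_of_isUnit_toQuot hu12)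
        have hrep : toQuot (4 * a.natAbs) (classRep' (q₁ * q₂)) =
            toQuot (4 * a.natAbs) (classRep' q₁ * classRep' q₂) := by
          rw [map_mul, toQuot_classRep', toQuot_classRep', toQuot_classRep']
        have hoprod : Odd (classRep' q₁ * classRep' q₂).norm.natAbs := by
          rw [Zsqrtd.norm_mul, Int.natAbs_mul]; exact ho1.mul ho2
        rw [jacobiSym_norm_eq_of_toQuot_eq hrep ho12 hoprod, Zsqrtd.norm_mul, Int.natAbs_mul,
          jacobiSym.mul_right' a ho1.pos.ne' ho2.pos.ne']
        push_cast
        ring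
      · have h12 : ¬ IsUnit (q₁ * q₂) := fun h ↦ h₂ (isUnit_of_mul_isUnit_right h)
        rw [if_neg h12, if_neg h₂, mul_zero]
    · have h12 : ¬ IsUnit (q₁ * q₂) := fun h ↦ h₁ (isUnit_of_mul_isUnit_left h)
      rw [if_neg h12, if_neg h₁, zero_mul]
  map_nonunit' q hq := if_neg hq

/-- **Values of the norm–Jacobi character**: for `z` with `(N z, 4|a|) = 1`,
`normJacobiChar a (z mod 4|a|) = (a / N z)`. [folklore] -/
theorem normJacobiChar_apply_toQuot {a : ℤ} {z : GaussianInt} (hz : Nat.Coprime z.norm.natAbs (4 * a.natAbs)) :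
    normJacobiChar a (toQuot (4 * a.natAbs) z) = ((jacobiSym a z.norm.natAbs : ℤ) : ℂ) := by
  have hu : IsUnit (toQuot (4 * a.natAbs) z) := isUnit_toQuot_of_coprime hz
  have h4 : 2 ∣ 4 * a.natAbs := Dvd.dvd.mul_right (by norm_num) _
  show (if IsUnit (toQuot (4 * a.natAbs) z) then
      ((jacobiSym a (classRep' (toQuot (4 * a.natAbs) z)).norm.natAbs : ℤ) : ℂ) else 0) = _
  rw [if_pos hu]
  have hrep : toQuot (4 * a.natAbs) (classRep' (toQuot (4 * a.natAbs) z)) = toQuot (4 * a.natAbs) z :=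
    toQuot_classRep' _
  have hu' : IsUnit (toQuot (4 * a.natAbs) (classRep' (toQuot (4 * a.natAbs) z))) := by rwa [hrep]
  rw [jacobiSym_norm_eq_of_toQuot_eq hrep (odd_of_coprime_of_two_dvd h4 (coprime_norm_of_isUnit_toQuot hu'))
    (odd_of_coprime_of_two_dvd h4 hz)]

/-- The norm–Jacobi character vanishes at classes whose norm is not prime to `4|a|`. [folklore] -/
theorem normJacobiChar_apply_toQuot_of_not_coprime {a : ℤ} {z : GaussianInt}
    (hz : ¬ Nat.Coprime z.norm.natAbs (4 * a.natAbs)) : normJacobiChar a (toQuot (4 * a.natAbs) z) = 0 :=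
  (normJacobiChar a).map_nonunit fun hu ↦ hz (coprime_norm_of_isUnit_toQuot hu)

end NormJacobi

end GaussianCosetTheta

end Literature.NumberTheory.LFunctions

end
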